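import Literature.Probability.RandomPlanarGeometry.HexSAWStripThresholdLinearLower
import HarnessLib

/-!
# The bridge series `B_T(x_c; y)` and the all-walks series `C_T(x_c; y)` of the strip are LINEARLY comparable up to the radius
# (BBdGDCG 2014, Corollary 8: "the series `A_T(x_c,y)`, `B_T(x_c,y)` and `C_T(x_c,y)` have radius of convergence `y_T`")

Topic `Literature/Probability/RandomPlanarGeometry` (continues `HexSAWStripThresholdLinearLower.lean` — the linear chain-to-bridge comparison
`HV.sum_pow_mul_stripZL_le_linear` in the boxes — and `HexSAWStripSurfaceThresholdRate.lean` — `HV.stripByLim = sup_L B_{T,L}`, bounded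
iff `y < y_T`, `HV.summable_pow_mul_stripZL_iff_lt_stripYT`, `HV.tendsto_stripByLim_nhdsLT_stripYT`).  Source: N. R. Beaton, M. Bousquet-Mélou,
J. de Gier, H. Duminil-Copin, A. J. Guttmann, *The critical fugacity for surface adsorption of self-avoiding walks on the honeycomb lattice is
`1 + √2`*, CMP 326 (2014), arXiv:1109.0358v5, §3.2 Corollary 8 (p. 12): "The series (in `y`) `A_T(x_c, y)`, `B_T(x_c, y)` and `C_T(x_c, y)` have
radius of convergence `y_T`" (here `C_T` is the lane's translation-class series `Σ_n x_c^n Z_{T,n}(y)` of `HexSAWStripSurfaceGrowth`; the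
common radius is in the tree).  Print compares the three radii only; the ORDER of magnitude of `C_T` relative to `B_T` near the radius is not
printed.

## What is proved (namespace `Literature.Probability.RandomPlanarGeometry.SAW.HV`; `x_c = hexCriticalFugacity`)

* `stripGFy_beta_le_mul_partialSum_stripZL` (`T ≥ 1`, `y ≥ 0`): `B_{T,L}(x_c; y) ≤ x_c · Σ_{n ≤ |V(S_{T,L})|} x_c^n Z_{T,n}(y)` — a `β`-walk is a chain
  from `O`.
* `stripByLim_le_mul_tsum_pow_mul_stripZL` (`T ≥ 1`, `0 < y < y_T`): `B_T(x_c; y) ≤ x_c · Σ_n x_c^n Z_{T,n}(y)`.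
* ★ `tsum_pow_mul_stripZL_le_linear_stripByLim` (`T ≥ 2`): `∃ K₁ K₂, 0 < K₂ ∧ ∀ y ∈ [1, y_T), Σ_n x_c^n Z_{T,n}(y) ≤ K₁ + K₂ · B_T(x_c; y)`.
* ★★ `stripByLim_linear_equivalent_tsum` (`T ≥ 2`): the two printed series are LINEARLY EQUIVALENT on `[1, y_T)`:
  `x_c⁻¹ B_T(x_c;y) ≤ C_T(x_c;y) ≤ K₁ + K₂ B_T(x_c;y)`; ★ `tendsto_tsum_pow_mul_stripZL_nhdsLT_stripYT` — `C_T(x_c; y) → +∞` as `y ↑ y_T`, and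
  `eventually_tsum_div_stripByLim_mem_Icc` — the ratio `C_T/B_T` is eventually in `[x_c⁻¹, K₂ + 1]` as `y ↑ y_T`: the two divergences have the same order.

Label: lane COROLLARY (S) of the linear comparison (tree) and the radius clause; lane «pcv-sawmu», a-p2 g17.  With the lane's first-order
bound (P) for `B_T` (banked «BRIDGE-RENEWAL»/MERGED) the divergence of `C_T(x_c; ·)` at `y_T` is first order too.  NOT claimed: (P) itself,
anything at `y ≥ y_T`, `T = 1` for the upper comparison (width one is explicit in the tree), uniformity in `T`.
-/

noncomputable section

open Finset Filter Topology Literature.Probability.LatticeModels Literature.Probability.Percolation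

namespace Literature.Probability.RandomPlanarGeometry.SAW.HV

open LinLow

variable {T : ℕ}

/-- `B_{T,L}(x_c; y) ≤ x_c · Σ_{n ≤ |V(S_{T,L})|} x_c^n Z_{T,n}(y)` (`T ≥ 1`, `y ≥ 0`): the inner list of a walk `a → β` of `S_{T,L}` is a chain of `S_T`
from `O` with at most `|V(S_{T,L})|` vertices. [cite: BeatonBousquetMelouDeGierDuminilCopinGuttmann2014, §3.2–§3.3 (B_T and C_T); DuminilCopinSmirnov2012, §3; lane] -/
theorem stripGFy_beta_le_mul_partialSum_stripZL (hT : 1 ≤ T) {y : ℝ} (hy : 0 ≤ y) (L : ℕ) :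
    stripGFy T L (IsBetaDart T) y ≤ hexCriticalFugacity * ∑ n ∈ range ((stripV T L).card + 1), hexCriticalFugacity ^ n * stripZL T n y := by
  classical
  have hx := hexCriticalFugacity_pos_lt_one.1
  rw [stripGFy_beta_eq_sum_bridgeLists hT, ← sum_cwt_chainsUpTo, mul_sum]
  have hmem : ∀ l ∈ bridgeLists T L, l ∈ chainsUpTo T ((stripV T L).card) := by
    intro l hl
    obtain ⟨hc, hh, hnd, hV, hne, -⟩ := (mem_bridgeLists_iff hT).1 hl
    have hlen : l.length ≤ (stripV T L).card := by
      rw [← List.toFinset_card_of_nodup hnd]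
      exact Finset.card_le_card fun v hv => hV v (List.mem_toFinset.1 hv)
    refine mem_chainsUpTo_of_mem (n := l.length - 1) ?_ (by omega)
    rw [mem_stripChains_iff]
    refine ⟨hc, hnd, by have := List.length_pos_of_ne_nil hne; omega, ⟨hvOrigin, hh, rfl⟩, fun v hv => ?_⟩
    have := lev_mem_of_mem_stripV (hV v hv)
    exact ⟨this.1, by exact_mod_cast this.2⟩
  calc ∑ l ∈ bridgeLists T L, hexCriticalFugacity ^ l.length * y ^ (l.filter fun v => lev v = 2 * (T : ℤ) - 1).length
      = ∑ l ∈ bridgeLists T L, hexCriticalFugacity * cwt T y l := by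
        refine sum_congr rfl fun l hl => ?_
        obtain ⟨-, -, -, -, hne, -⟩ := (mem_bridgeLists_iff hT).1 hl
        have h1 : l.length = (l.length - 1) + 1 := by have := List.length_pos_of_ne_nil hne; omega
        rw [cwt, topCnt]
        conv_lhs => rw [h1, pow_succ]
        ring
    _ ≤ ∑ l ∈ chainsUpTo T ((stripV T L).card), hexCriticalFugacity * cwt T y l :=
        sum_le_sum_of_subset_of_nonneg (fun l hl => hmem l hl) fun l _ _ => mul_nonneg hx.le (cwt_nonneg T hy l)

/-- `B_T(x_c; y) ≤ x_c · Σ_n x_c^n Z_{T,n}(y)` for `0 < y < y_T` (`T ≥ 1`). [cite: BeatonBousquetMelouDeGierDuminilCopinGuttmann2014, Corollary 8 (arXiv v5 p. 12); lane] -/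
theorem stripByLim_le_mul_tsum_pow_mul_stripZL (hT : 1 ≤ T) {y : ℝ} (hy : 0 < y) (hyT : y < stripYT T) :
    stripByLim T y ≤ hexCriticalFugacity * ∑' n, hexCriticalFugacity ^ n * stripZL T n y := by
  have hx := hexCriticalFugacity_pos_lt_one.1
  have hs' := (summable_pow_mul_stripZL_iff_lt_stripYT hT hy).2 hyT
  have hs : Summable fun n => hexCriticalFugacity ^ n * stripZL T n y := by
    have := hs'.mul_left hexCriticalFugacity⁻¹
    refine this.congr fun n => ?_
    rw [pow_succ]; field_simp
  have h0 : ∀ n, 0 ≤ hexCriticalFugacity ^ n * stripZL T n y := fun n => mul_nonneg (pow_nonneg hx.le _) (stripZL_nonneg T n hy.le)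
  refine ciSup_le fun L => (stripGFy_beta_le_mul_partialSum_stripZL hT hy.le L).trans ?_
  exact mul_le_mul_of_nonneg_left (hs.sum_le_tsum _ fun n _ => h0 n) hx.le

/-- ★ `Σ_n x_c^n Z_{T,n}(y) ≤ K₁ + K₂ · B_T(x_c; y)` for `y ∈ [1, y_T)` (`T ≥ 2`; the linear comparison of the boxes, `B_{T,N} ≤ B_T`).
[cite: BeatonBousquetMelouDeGierDuminilCopinGuttmann2014, Corollary 8 (arXiv v5 p. 12); lane] -/
theorem tsum_pow_mul_stripZL_le_linear_stripByLim (hT : 2 ≤ T) :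
    ∃ K₁ K₂ : ℝ, 0 < K₂ ∧ ∀ y : ℝ, 1 ≤ y → y < stripYT T →
      ∑' n, hexCriticalFugacity ^ n * stripZL T n y ≤ K₁ + K₂ * stripByLim T y := by
  have hT1 : 1 ≤ T := by omega
  have hx := hexCriticalFugacity_pos_lt_one.1
  obtain ⟨K₁, K₂, hK₂, hK⟩ := sum_pow_mul_stripZL_le_linear hT
  refine ⟨K₁, K₂, hK₂, fun y hy1 hyT => ?_⟩
  have hy0 : 0 < y := by linarith
  have hs' := (summable_pow_mul_stripZL_iff_lt_stripYT hT1 hy0).2 hyT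
  have hs : Summable fun n => hexCriticalFugacity ^ n * stripZL T n y := by
    have := hs'.mul_left hexCriticalFugacity⁻¹
    refine this.congr fun n => ?_
    rw [pow_succ]; field_simp
  have h0 : ∀ n, 0 ≤ hexCriticalFugacity ^ n * stripZL T n y := fun n => mul_nonneg (pow_nonneg hx.le _) (stripZL_nonneg T n hy0.le)
  have hbdd := (bddAbove_stripGFy_beta_iff_lt_stripYT hT1 hy0.le).2 hyT
  refine Real.tsum_le_of_sum_range_le h0 fun N => ?_
  have hBN : stripGFy T N (IsBetaDart T) y ≤ stripByLim T y := le_ciSup hbdd N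
  calc ∑ n ∈ range N, hexCriticalFugacity ^ n * stripZL T n y ≤ ∑ n ∈ range (N + 1), hexCriticalFugacity ^ n * stripZL T n y :=
        sum_le_sum_of_subset_of_nonneg (range_subset_range.2 (Nat.le_succ N)) fun n _ _ => h0 n
    _ ≤ K₁ + K₂ * stripGFy T N (IsBetaDart T) y := hK y hy1 hyT.le N
    _ ≤ K₁ + K₂ * stripByLim T y := by nlinarith [hBN, hK₂]

/-- ★★ **`B_T(x_c; ·)` and `C_T(x_c; ·) = Σ_n x_c^n Z_{T,n}(·)` are linearly equivalent on `[1, y_T)`** (`T ≥ 2`):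
`x_c⁻¹ · B_T(x_c; y) ≤ C_T(x_c; y) ≤ K₁ + K₂ · B_T(x_c; y)`. [cite: BeatonBousquetMelouDeGierDuminilCopinGuttmann2014, Corollary 8 (arXiv v5 p. 12: common radius y_T); lane «pcv-sawmu»: the common ORDER near the radius] -/
theorem stripByLim_linear_equivalent_tsum (hT : 2 ≤ T) :
    ∃ K₁ K₂ : ℝ, 0 < K₂ ∧ ∀ y : ℝ, 1 ≤ y → y < stripYT T →
      hexCriticalFugacity⁻¹ * stripByLim T y ≤ ∑' n, hexCriticalFugacity ^ n * stripZL T n y ∧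
        ∑' n, hexCriticalFugacity ^ n * stripZL T n y ≤ K₁ + K₂ * stripByLim T y := by
  have hT1 : 1 ≤ T := by omega
  have hx := hexCriticalFugacity_pos_lt_one.1
  obtain ⟨K₁, K₂, hK₂, hK⟩ := tsum_pow_mul_stripZL_le_linear_stripByLim hT
  refine ⟨K₁, K₂, hK₂, fun y hy1 hyT => ⟨?_, hK y hy1 hyT⟩⟩
  rw [inv_mul_le_iff₀ hx]
  exact stripByLim_le_mul_tsum_pow_mul_stripZL hT1 (by linarith) hyT

/-- ★ `C_T(x_c; y) → +∞` as `y ↑ y_T` (`T ≥ 1`): from `B_T(x_c; y) → +∞` and `B_T ≤ x_c C_T`.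
[cite: BeatonBousquetMelouDeGierDuminilCopinGuttmann2014, Corollary 8 and its proof (arXiv v5 pp. 12–13: C_T(x_c,y) diverges if x_c > ρ_T(y)); lane: divergence FROM THE LEFT at the radius] -/
theorem tendsto_tsum_pow_mul_stripZL_nhdsLT_stripYT (hT : 1 ≤ T) :
    Tendsto (fun y : ℝ => ∑' n, hexCriticalFugacity ^ n * stripZL T n y) (𝓝[<] stripYT T) atTop := by
  have hx := hexCriticalFugacity_pos_lt_one.1
  have hB := tendsto_stripByLim_nhdsLT_stripYT hT
  have hev : ∀ᶠ y : ℝ in 𝓝[<] stripYT T, hexCriticalFugacity⁻¹ * stripByLim T y ≤ ∑' n, hexCriticalFugacity ^ n * stripZL T n y := by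
    have hmem : Set.Ioo (0 : ℝ) (stripYT T) ∈ 𝓝[<] stripYT T := Ioo_mem_nhdsLT (stripYT_pos hT)
    filter_upwards [hmem] with y hy
    rw [inv_mul_le_iff₀ hx]
    exact stripByLim_le_mul_tsum_pow_mul_stripZL hT hy.1 hy.2
  refine tendsto_atTop_mono' _ hev ?_
  exact Tendsto.const_mul_atTop (inv_pos.2 hx) hB

/-- The ratio `C_T(x_c; y) / B_T(x_c; y)` is eventually in `[x_c⁻¹, K₂ + 1]` as `y ↑ y_T` (`T ≥ 2`): the two divergences have the same order.
[cite: BeatonBousquetMelouDeGierDuminilCopinGuttmann2014, Corollary 8 (arXiv v5 p. 12); lane] -/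
theorem eventually_tsum_div_stripByLim_mem_Icc (hT : 2 ≤ T) :
    ∃ K : ℝ, ∀ᶠ y : ℝ in 𝓝[<] stripYT T,
      (∑' n, hexCriticalFugacity ^ n * stripZL T n y) / stripByLim T y ∈ Set.Icc hexCriticalFugacity⁻¹ K := by
  have hT1 : 1 ≤ T := by omega
  have hx := hexCriticalFugacity_pos_lt_one.1
  obtain ⟨K₁, K₂, hK₂, hK⟩ := stripByLim_linear_equivalent_tsum hT
  have hB := tendsto_stripByLim_nhdsLT_stripYT hT1
  refine ⟨K₂ + 1, ?_⟩
  have hmem : Set.Ico (1 : ℝ) (stripYT T) ∈ 𝓝[<] stripYT T := Ico_mem_nhdsLT (one_lt_stripYT hT1)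
  filter_upwards [hmem, hB.eventually_ge_atTop (max K₁ 1)] with y hy hBy
  obtain ⟨h1, h2⟩ := hK y hy.1 hy.2
  have hBpos : 0 < stripByLim T y := lt_of_lt_of_le one_pos ((le_max_right _ _).trans hBy)
  constructor
  · rw [le_div_iff₀ hBpos]; linarith
  · rw [div_le_iff₀ hBpos]
    have : K₁ ≤ stripByLim T y := (le_max_left _ _).trans hBy
    nlinarith

end Literature.Probability.RandomPlanarGeometry.SAW.HV
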